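import Summits.SmoothPoincare4.SmoothPoincare4.Theses.SullivanDual
import HarnessLib

/-!
# `TargetOfCruxes` — the two cruxes of route SullivanDual imply its target (pure logic)

Route `SmoothPoincare4/SullivanDual`, support item stmt-SmoothPoincare4-7831 (`TargetOfCruxes`):
`WitnessCharge → HyperbolicEnd → Target`.

* `HyperbolicEnd` supplies, for every homotopy 4-sphere `Σ` and `p ∈ Σ`, a smooth `J` with `J² = -1` on `Σ∖p`,
  standard on the punctured `ε'`-chart-ball (with `closedBall (e p) ε' ⊆` chart target), admitting for every
  `0 < ε < ε'` NO non-constant smooth `J`-holomorphic `u : ℂ → Σ∖p` avoiding `B_ε`.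
* `WitnessCharge` says that for such data and `0 < ε < ε'`, a taming witness `T` at radius `ε` (conditions
  (W1)–(W3)) produces exactly such a `u`.
* Hence, with `ε₁ := ε'/2`, for every `0 < ε ≤ ε₁` (so `ε < ε'`) no taming witness exists: this is `Target` for the
  `J` of `HyperbolicEnd`.

No analysis enters; the three statement texts match syntactically (the witness conditions of `Target` are those of
the hypothesis of `WitnessCharge`, and its conclusion is the negand of `HyperbolicEnd`).

References: D. Sullivan, *Cycles for the dynamical study of foliated manifolds and complex manifolds*,
Invent. Math. 36 (1976) (doi:10.1007/BF01390011) — context only; the present file is bookkeeping.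
-/

-- the prescribed namespace `Summit.<P>.<Sub>.…` duplicates `SmoothPoincare4` (P = Sub)
set_option linter.dupNamespace false

namespace Summit.SmoothPoincare4.SmoothPoincare4.Theorems

open Summit.SmoothPoincare4.SmoothPoincare4.Theses.SullivanDual

/-- **Item stmt-SmoothPoincare4-7831 (`TargetOfCruxes`).** `WitnessCharge → HyperbolicEnd → Target`: take `J, ε'` from
`HyperbolicEnd` and `ε₁ := ε' / 2`; for `0 < ε ≤ ε₁ < ε'` a taming witness `T` at radius `ε` would be charged by
`WitnessCharge` with a non-constant smooth `J`-holomorphic entire curve avoiding `B_ε`, which `HyperbolicEnd` forbids.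
Pure logic. -/
theorem targetOfCruxes_proof : Summit.SmoothPoincare4.SmoothPoincare4.Theses.SullivanDual.TargetOfCruxes := by
  unfold TargetOfCruxes
  intro hWC hHE S p
  obtain ⟨J, ε', hε', hball, hJ2, hJs, hJstd, hno⟩ := hHE S p
  refine ⟨J, hJ2, hJs, ε' / 2, half_pos hε', fun ε hε hεle T hW => ?_⟩
  have hlt : ε < ε' := lt_of_le_of_lt hεle (half_lt_self hε')
  exact hno ε hε hlt (hWC S p J ε ε' hε hlt hball hJ2 hJs hJstd ⟨T, hW⟩)

end Summit.SmoothPoincare4.SmoothPoincare4.Theorems
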